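import Mathlib
import Summits.SmoothPoincare4.SmoothPoincare4.Theorems.SoloBlindGenericState

/-!
# Cusp congruences of a child direction (solo-blind s7)

Two exact divisibilities used in `paper/cs-gompf-classes.md` §4d R22 (margin-transfer law) and §4c R19
(solo seat `solo-SmoothPoincare4-blind`).  For a state `J = (c, d)` (`d ∣ f_t(c)`,
`fPoly t c = c³ - t c² + (t-1) c - 1`) and a direction `G = A x² + B x + C` of the colon lattice `Λ_J`, the
CUSP LEMMA (`cusp_lemma`, kernel-landed in `SoloBlindGenericState`) gives `P = G(0) ≡ A c̄` and
`Q = G(1) ≡ A/(c-1)` modulo `d`, i.e. `d ∣ c P - A` and `d ∣ (c-1) Q - A`.  From these: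

1. `cusp_E_identity` / `cusp_E_dvd`: the MARGIN NUMERATOR `E = A Q - A P - P Q` satisfies
   `c (c-1) · E = (c-1) A ((c-1) Q - A) - c A (c P - A) - (c P - A)((c-1) Q - A)` identically, hence
   `d ∣ E` as soon as `c (c-1)` is invertible modulo `d` (it is: `c` and `c - 1` are units modulo `d` for every
   state, by `f_t(c) = c (c² - t c + t - 1) - 1 = (c-1)(c² - (t-1) c) - 1`; recorded as `state_units`).  So the
   empirical law `μ(J') ≈ |E| · min(|A|,|P|,|Q|) / d` of R22 is a statement about the INTEGER `E/d`.
2. `cusp_Phi_identity` / `cusp_Phi_dvd`: the homogenised state polynomial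
   `Φ_t(A, P) = A³ - t A² P + (t-1) A P² - P³` satisfies
   `Φ_t(A,P) = P³ f_t(c) + (A - c P)(A² + A c P + c² P² - t P (A + c P) + (t-1) P²)`, hence `d ∣ Φ_t(A, P)`.
Pure algebra; nothing numerical is claimed.
-/

namespace Summit.SmoothPoincare4.SmoothPoincare4.Theorems

section Identities
variable {R : Type*} [CommRing R]

/-- The margin numerator times `c (c-1)` in terms of the two cusp congruence residues. -/
theorem cusp_E_identity (c A P Q : R) :
    c * (c - 1) * (A * Q - A * P - P * Q) =
      (c - 1) * A * ((c - 1) * Q - A) - c * A * (c * P - A) - (c * P - A) * ((c - 1) * Q - A) := by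
  ring

/-- The homogenised state polynomial in terms of `f_t(c)` and the cusp residue `A - c P`. -/
theorem cusp_Phi_identity (t c A P : R) :
    A ^ 3 - t * A ^ 2 * P + (t - 1) * A * P ^ 2 - P ^ 3 =
      P ^ 3 * fPoly t c +
        (A - c * P) * (A ^ 2 + A * c * P + c ^ 2 * P ^ 2 - t * P * (A + c * P) + (t - 1) * P ^ 2) := by
  unfold fPoly; ring

/-- For a state, `c` and `c - 1` are units modulo `d`: explicit inverses from `f_t(c)`. -/
theorem state_units (t c : R) :
    c * (c ^ 2 - t * c + (t - 1)) - 1 = fPoly t c ∧ (c - 1) * (c ^ 2 - (t - 1) * c) - 1 = fPoly t c := by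
  unfold fPoly; constructor <;> ring

end Identities

/-- `d ∣ E = A Q - A P - P Q` from the cusp congruences, when `c (c-1)` is invertible mod `d`. -/
theorem cusp_E_dvd (d c A P Q : ℤ) (hP : d ∣ c * P - A) (hQ : d ∣ (c - 1) * Q - A)
    (hcop : IsCoprime (c * (c - 1)) d) : d ∣ A * Q - A * P - P * Q := by
  have h : d ∣ c * (c - 1) * (A * Q - A * P - P * Q) := by
    rw [cusp_E_identity]
    exact dvd_sub (dvd_sub (Dvd.dvd.mul_left hQ _) (Dvd.dvd.mul_left hP _)) (Dvd.dvd.mul_right hP _)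
  exact hcop.symm.dvd_of_dvd_mul_left h

/-- `c (c-1)` is invertible modulo `d` for every state `(c, d)` at the fibre `t`. -/
theorem state_coprime (d t c : ℤ) (hf : d ∣ fPoly t c) : IsCoprime (c * (c - 1)) d := by
  obtain ⟨k, hk⟩ := hf
  have h1 : c * (c ^ 2 - t * c + (t - 1)) - 1 = d * k := by rw [← hk]; unfold fPoly; ring
  have h2 : (c - 1) * (c ^ 2 - (t - 1) * c) - 1 = d * k := by rw [← hk]; unfold fPoly; ring
  have hc : IsCoprime c d := ⟨c ^ 2 - t * c + (t - 1), -k, by linarith⟩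
  have hc1 : IsCoprime (c - 1) d := ⟨c ^ 2 - (t - 1) * c, -k, by linarith⟩
  exact hc.mul_left hc1

/-- `d ∣ Φ_t(A, P) = A³ - t A² P + (t-1) A P² - P³` from `d ∣ f_t(c)` and `d ∣ c P - A`. -/
theorem cusp_Phi_dvd (d t c A P : ℤ) (hf : d ∣ fPoly t c) (hP : d ∣ c * P - A) :
    d ∣ A ^ 3 - t * A ^ 2 * P + (t - 1) * A * P ^ 2 - P ^ 3 := by
  rw [cusp_Phi_identity]
  have hP' : d ∣ A - c * P := by
    have e : A - c * P = -(c * P - A) := by ring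
    rw [e]; exact Dvd.dvd.neg_right hP
  exact dvd_add (Dvd.dvd.mul_left hf _) (Dvd.dvd.mul_right hP' _)

end Summit.SmoothPoincare4.SmoothPoincare4.Theorems
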